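import Literature.AlgebraicGeometry.Modules.RankOneCocycle
import HarnessLib

/-!
# Line bundles with cohomologous cocycles are isomorphic

Continuation of `Modules/RankOneCocycle.lean`. For `𝒪_X`-modules `E₁`, `E₂` with frame systems of
constant rank `1` and a coboundary `g²_{xy} λ_y = λ_x g¹_{xy}` between their determinant cocycles, the
local isomorphisms `φ_x : E₁|_{W_x} → E₂|_{W_x}`, `b¹_x ↦ λ_x b²_x` (`localHom`) agree on overlaps
(`localHom_compatible`) and glue (`Modules/SheafHom.lean`, `glueHom`) to an isomorphism `E₁ ≅ E₂`
(`nonempty_iso_of_coboundary`; Hartshorne III Ex. 4.5: `Pic X → Ȟ¹(X, 𝒪_X^×)` is injective). With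
`detClass_eq_mk`: **line bundles with the same determinant class are isomorphic**
(`nonempty_iso_of_cocycle_equiv`). Everything is proved; no named facts.

## References

* R. Hartshorne, *Algebraic Geometry*, GTM 52 (1977), III Ex. 4.5. [Hartshorne1977]
-/

noncomputable section

open CategoryTheory AlgebraicGeometry Opposite TopologicalSpace Limits

namespace Literature.AlgebraicGeometry.Modules

open Literature.AlgebraicGeometry.Motives

universe u

variable {X : Scheme.{u}} {E₁ E₂ : X.Modules}

section Iso

variable (F₁ : FrameSystem E₁) (F₂ : FrameSystem E₂) (h₁ : ∀ x, F₁.rank x = 1)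
  (h₂ : ∀ x, F₂.rank x = 1) (b : UnitCocycle.Coboundary F₁.cocycle F₂.cocycle)

/-- The local isomorphism `E₁|_{W_x} → E₂|_{W_x}`, `b¹_x ↦ λ_x b²_x`. [folklore] -/
def localHom (x : X) : E₁.over (b.W x) ⟶ E₂.over (b.W x) :=
  homOfBasisValues (SheafOfModules.restrictTrivialisation (R := X.ringCatSheaf) (homOfLE (b.le x))
    (F₁.frame x)) fun _ => b.lam x (b.W x) le_rfl •
      E₂.presheaf.map (homOfLE (b.le' x)).op (basisSection (F₂.frame x) (F₂.idx h₂ x))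

/-- The local inverse `E₂|_{W_x} → E₁|_{W_x}`, `b²_x ↦ λ_x⁻¹ b¹_x`. [folklore] -/
def localInv (x : X) : E₂.over (b.W x) ⟶ E₁.over (b.W x) :=
  homOfBasisValues (SheafOfModules.restrictTrivialisation (R := X.ringCatSheaf) (homOfLE (b.le' x))
    (F₂.frame x)) fun _ => b.inv x (b.W x) le_rfl •
      E₁.presheaf.map (homOfLE (b.le x)).op (basisSection (F₁.frame x) (F₁.idx h₁ x))

include h₁ h₂ in
/-- `φ_x(b¹_x|_V) = λ_x b²_x|_V`. [folklore] -/
lemma appLE_localHom_gen (x : X) {V : X.Opens} (k : V ⟶ b.W x) :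
    appLE (localHom F₁ F₂ h₂ b x) k (E₁.presheaf.map (k ≫ homOfLE (b.le x)).op (basisSection (F₁.frame x) (F₁.idx h₁ x))) =
      b.lam x V k.le • E₂.presheaf.map (k ≫ homOfLE (b.le' x)).op (basisSection (F₂.frame x) (F₂.idx h₂ x)) := by
  have htop := appLE_homOfBasisValues (M := E₂) (SheafOfModules.restrictTrivialisation
    (R := X.ringCatSheaf) (homOfLE (b.le x)) (F₁.frame x)) (fun _ => b.lam x (b.W x) le_rfl •
      E₂.presheaf.map (homOfLE (b.le' x)).op (basisSection (F₂.frame x) (F₂.idx h₂ x))) (F₁.idx h₁ x)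
  rw [basisSection_restrictTrivialisation] at htop
  rw [← presheaf_map_map, ← presheaf_map_map E₂, appLE_congr_hom _ k (k ≫ 𝟙 _)]
  change appLE (homOfBasisValues _ _) (k ≫ 𝟙 _) (E₁.presheaf.map k.op _) = _
  rw [appLE_map, htop, Scheme.Modules.map_smul]
  congr 1
  exact b.map_lam x le_rfl k.le

include h₁ h₂ in
/-- `ψ_x(b²_x|_V) = λ_x⁻¹ b¹_x|_V`. [folklore] -/
lemma appLE_localInv_gen (x : X) {V : X.Opens} (k : V ⟶ b.W x) :
    appLE (localInv F₁ F₂ h₁ b x) k (E₂.presheaf.map (k ≫ homOfLE (b.le' x)).op (basisSection (F₂.frame x) (F₂.idx h₂ x))) =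
      b.inv x V k.le • E₁.presheaf.map (k ≫ homOfLE (b.le x)).op (basisSection (F₁.frame x) (F₁.idx h₁ x)) := by
  have htop := appLE_homOfBasisValues (M := E₁) (SheafOfModules.restrictTrivialisation
    (R := X.ringCatSheaf) (homOfLE (b.le' x)) (F₂.frame x)) (fun _ => b.inv x (b.W x) le_rfl •
      E₁.presheaf.map (homOfLE (b.le x)).op (basisSection (F₁.frame x) (F₁.idx h₁ x))) (F₂.idx h₂ x)
  rw [basisSection_restrictTrivialisation] at htop
  rw [← presheaf_map_map, ← presheaf_map_map E₁, appLE_congr_hom _ k (k ≫ 𝟙 _)]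
  change appLE (homOfBasisValues _ _) (k ≫ 𝟙 _) (E₂.presheaf.map k.op _) = _
  rw [appLE_map, htop, Scheme.Modules.map_smul]
  congr 1
  exact b.map_inv x le_rfl k.le

include h₁ h₂ in
/-- `φ_x(b¹_x|_V) = λ_x b²_x|_V`, with the restrictions written through `V ≤ U_x`. [folklore] -/
lemma appLE_localHom_gen' (x : X) {V : X.Opens} (k : V ⟶ b.W x) (hx₁ : V ≤ F₁.U x)
    (hx₂ : V ≤ F₂.U x) :
    appLE (localHom F₁ F₂ h₂ b x) k
        (E₁.presheaf.map (homOfLE hx₁).op (basisSection (F₁.frame x) (F₁.idx h₁ x))) =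
      b.lam x V k.le • E₂.presheaf.map (homOfLE hx₂).op (basisSection (F₂.frame x) (F₂.idx h₂ x)) := by
  have h := appLE_localHom_gen F₁ F₂ h₁ h₂ b x k
  have e1 : k ≫ homOfLE (b.le x) = homOfLE hx₁ := Subsingleton.elim _ _
  have e2 : k ≫ homOfLE (b.le' x) = homOfLE hx₂ := Subsingleton.elim _ _
  rw [e1, e2] at h
  exact h

include h₁ h₂ in
/-- `ψ_x(b²_x|_V) = λ_x⁻¹ b¹_x|_V`, with the restrictions written through `V ≤ U_x`. [folklore] -/
lemma appLE_localInv_gen' (x : X) {V : X.Opens} (k : V ⟶ b.W x) (hx₁ : V ≤ F₁.U x)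
    (hx₂ : V ≤ F₂.U x) :
    appLE (localInv F₁ F₂ h₁ b x) k
        (E₂.presheaf.map (homOfLE hx₂).op (basisSection (F₂.frame x) (F₂.idx h₂ x))) =
      b.inv x V k.le • E₁.presheaf.map (homOfLE hx₁).op (basisSection (F₁.frame x) (F₁.idx h₁ x)) := by
  have h := appLE_localInv_gen F₁ F₂ h₁ h₂ b x k
  have e1 : k ≫ homOfLE (b.le' x) = homOfLE hx₂ := Subsingleton.elim _ _
  have e2 : k ≫ homOfLE (b.le x) = homOfLE hx₁ := Subsingleton.elim _ _
  rw [e1, e2] at h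
  exact h

include h₁ h₂ in
/-- **The local isomorphisms agree on overlaps** (this is where `g²_{xy} λ_y = λ_x g¹_{xy}` is used).
[folklore] -/
theorem localHom_compatible (x y : X) :
    restrictHom (Opens.infLELeft (b.W x) (b.W y)) (localHom F₁ F₂ h₂ b x) =
      restrictHom (Opens.infLERight (b.W x) (b.W y)) (localHom F₁ F₂ h₂ b y) := by
  have hx₁ : b.W x ⊓ b.W y ≤ F₁.U x := inf_le_left.trans (b.le x)
  have hy₁ : b.W x ⊓ b.W y ≤ F₁.U y := inf_le_right.trans (b.le y)
  have hx₂ : b.W x ⊓ b.W y ≤ F₂.U x := inf_le_left.trans (b.le' x)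
  have hy₂ : b.W x ⊓ b.W y ≤ F₂.U y := inf_le_right.trans (b.le' y)
  -- compare on the basis `b¹_x|` of `E₁|_{W_x ⊓ W_y}`
  refine hom_ext_of_basisSection (SheafOfModules.restrictTrivialisation (R := X.ringCatSheaf)
    (homOfLE hx₁) (F₁.frame x)) fun i => ?_
  obtain rfl : i = F₁.idx h₁ x := F₁.eq_idx h₁ x i
  rw [basisSection_restrictTrivialisation, appLE_restrictHom, appLE_restrictHom]
  show appLE (localHom F₁ F₂ h₂ b x) (𝟙 _ ≫ Opens.infLELeft (b.W x) (b.W y))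
      (E₁.presheaf.map (homOfLE hx₁).op (basisSection (F₁.frame x) (F₁.idx h₁ x))) =
    appLE (localHom F₁ F₂ h₂ b y) (𝟙 _ ≫ Opens.infLERight (b.W x) (b.W y))
      (E₁.presheaf.map (homOfLE hx₁).op (basisSection (F₁.frame x) (F₁.idx h₁ x)))
  rw [appLE_localHom_gen' F₁ F₂ h₁ h₂ b x _ hx₁ hx₂, F₁.map_gen_eq h₁ hy₁ hx₁, appLE_smul_right,
    appLE_localHom_gen' F₁ F₂ h₁ h₂ b y _ hy₁ hy₂, F₂.map_gen_eq h₂ hx₂ hy₂, smul_smul, smul_smul]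
  congr 1
  -- `λ_x = g¹_{yx} λ_y g²_{xy}`
  have hrel := b.rel x y (b.W x ⊓ b.W y) inf_le_left inf_le_right
  have hinv := F₁.cocycle.g_mul_symm x y (b.W x ⊓ b.W y) hx₁ hy₁
  change F₂.cocycle.g x y _ hx₂ hy₂ * _ = _ * F₁.cocycle.g x y _ hx₁ hy₁ at hrel
  linear_combination (-F₁.cocycle.g y x _ hy₁ hx₁) * hrel -
    b.lam x (b.W x ⊓ b.W y) inf_le_left * hinv

include h₁ h₂ in
/-- The local inverses agree on overlaps. [folklore] -/
theorem localInv_compatible (x y : X) :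
    restrictHom (Opens.infLELeft (b.W x) (b.W y)) (localInv F₁ F₂ h₁ b x) =
      restrictHom (Opens.infLERight (b.W x) (b.W y)) (localInv F₁ F₂ h₁ b y) := by
  have hx₁ : b.W x ⊓ b.W y ≤ F₁.U x := inf_le_left.trans (b.le x)
  have hy₁ : b.W x ⊓ b.W y ≤ F₁.U y := inf_le_right.trans (b.le y)
  have hx₂ : b.W x ⊓ b.W y ≤ F₂.U x := inf_le_left.trans (b.le' x)
  have hy₂ : b.W x ⊓ b.W y ≤ F₂.U y := inf_le_right.trans (b.le' y)
  refine hom_ext_of_basisSection (SheafOfModules.restrictTrivialisation (R := X.ringCatSheaf)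
    (homOfLE hx₂) (F₂.frame x)) fun i => ?_
  obtain rfl : i = F₂.idx h₂ x := F₂.eq_idx h₂ x i
  rw [basisSection_restrictTrivialisation, appLE_restrictHom, appLE_restrictHom]
  show appLE (localInv F₁ F₂ h₁ b x) (𝟙 _ ≫ Opens.infLELeft (b.W x) (b.W y))
      (E₂.presheaf.map (homOfLE hx₂).op (basisSection (F₂.frame x) (F₂.idx h₂ x))) =
    appLE (localInv F₁ F₂ h₁ b y) (𝟙 _ ≫ Opens.infLERight (b.W x) (b.W y))
      (E₂.presheaf.map (homOfLE hx₂).op (basisSection (F₂.frame x) (F₂.idx h₂ x)))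
  rw [appLE_localInv_gen' F₁ F₂ h₁ h₂ b x _ hx₁ hx₂, F₂.map_gen_eq h₂ hy₂ hx₂, appLE_smul_right,
    appLE_localInv_gen' F₁ F₂ h₁ h₂ b y _ hy₁ hy₂, F₁.map_gen_eq h₁ hx₁ hy₁, smul_smul, smul_smul]
  congr 1
  have hrel := b.rel_inv x y (b.W x ⊓ b.W y) inf_le_left inf_le_right
  have hinv := F₂.cocycle.g_mul_symm x y (b.W x ⊓ b.W y) hx₂ hy₂
  change F₁.cocycle.g x y _ hx₁ hy₁ * _ = _ * F₂.cocycle.g x y _ hx₂ hy₂ at hrel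
  linear_combination (-F₂.cocycle.g y x _ hy₂ hx₂) * hrel -
    b.inv x (b.W x ⊓ b.W y) inf_le_left * hinv

include h₁ h₂ in
/-- `φ_x ≫ ψ_x = 𝟙`. [folklore] -/
lemma localHom_comp_localInv (x : X) : localHom F₁ F₂ h₂ b x ≫ localInv F₁ F₂ h₁ b x = 𝟙 _ := by
  have hx₁ : b.W x ≤ F₁.U x := b.le x
  have hx₂ : b.W x ≤ F₂.U x := b.le' x
  refine hom_ext_of_basisSection (SheafOfModules.restrictTrivialisation (R := X.ringCatSheaf)
    (homOfLE hx₁) (F₁.frame x)) fun i => ?_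
  obtain rfl : i = F₁.idx h₁ x := F₁.eq_idx h₁ x i
  rw [basisSection_restrictTrivialisation, appLE_comp, appLE_id]
  show appLE (localInv F₁ F₂ h₁ b x) (𝟙 _) (appLE (localHom F₁ F₂ h₂ b x) (𝟙 _)
      (E₁.presheaf.map (homOfLE hx₁).op (basisSection (F₁.frame x) (F₁.idx h₁ x)))) =
    E₁.presheaf.map (homOfLE hx₁).op (basisSection (F₁.frame x) (F₁.idx h₁ x))
  rw [appLE_localHom_gen' F₁ F₂ h₁ h₂ b x _ hx₁ hx₂, appLE_smul_right,
    appLE_localInv_gen' F₁ F₂ h₁ h₂ b x _ hx₁ hx₂, smul_smul, b.lam_mul_inv, one_smul]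

include h₁ h₂ in
/-- `ψ_x ≫ φ_x = 𝟙`. [folklore] -/
lemma localInv_comp_localHom (x : X) : localInv F₁ F₂ h₁ b x ≫ localHom F₁ F₂ h₂ b x = 𝟙 _ := by
  have hx₁ : b.W x ≤ F₁.U x := b.le x
  have hx₂ : b.W x ≤ F₂.U x := b.le' x
  refine hom_ext_of_basisSection (SheafOfModules.restrictTrivialisation (R := X.ringCatSheaf)
    (homOfLE hx₂) (F₂.frame x)) fun i => ?_
  obtain rfl : i = F₂.idx h₂ x := F₂.eq_idx h₂ x i
  rw [basisSection_restrictTrivialisation, appLE_comp, appLE_id]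
  show appLE (localHom F₁ F₂ h₂ b x) (𝟙 _) (appLE (localInv F₁ F₂ h₁ b x) (𝟙 _)
      (E₂.presheaf.map (homOfLE hx₂).op (basisSection (F₂.frame x) (F₂.idx h₂ x)))) =
    E₂.presheaf.map (homOfLE hx₂).op (basisSection (F₂.frame x) (F₂.idx h₂ x))
  rw [appLE_localInv_gen' F₁ F₂ h₁ h₂ b x _ hx₁ hx₂, appLE_smul_right,
    appLE_localHom_gen' F₁ F₂ h₁ h₂ b x _ hx₁ hx₂, smul_smul, mul_comm, b.lam_mul_inv, one_smul]

include F₁ F₂ h₁ h₂ b in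
/-- **Two rank-one framed modules with cohomologous cocycles are isomorphic** (glue the `φ_x`).
[cite: Hartshorne1977, III Ex. 4.5] -/
theorem nonempty_iso_of_coboundary : Nonempty (E₁ ≅ E₂) := by
  let Φ := glueHom b.W (localHom F₁ F₂ h₂ b) (localHom_compatible F₁ F₂ h₁ h₂ b)
  let Ψ := glueHom b.W (localInv F₁ F₂ h₁ b) (localInv_compatible F₁ F₂ h₁ h₂ b)
  have hid₁ : ∀ x y : X, restrictHom (Opens.infLELeft (b.W x) (b.W y)) (𝟙 (E₁.over (b.W x))) =
      restrictHom (Opens.infLERight (b.W x) (b.W y)) (𝟙 (E₁.over (b.W y))) := fun x y => by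
    rw [restrictHom_id, restrictHom_id]
  have hid₂ : ∀ x y : X, restrictHom (Opens.infLELeft (b.W x) (b.W y)) (𝟙 (E₂.over (b.W x))) =
      restrictHom (Opens.infLERight (b.W x) (b.W y)) (𝟙 (E₂.over (b.W y))) := fun x y => by
    rw [restrictHom_id, restrictHom_id]
  have hΦΨ : Φ ≫ Ψ = 𝟙 _ := by
    have e1 : Φ ≫ Ψ = glueHom b.W (fun x => 𝟙 _) hid₁ :=
      eq_glueHom _ _ _ _ fun x => by
        rw [restrictHom_comp, restrictHom_glueHom, restrictHom_glueHom,
          localHom_comp_localInv F₁ F₂ h₁ h₂]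
    have e2 : (𝟙 _ : E₁.over (iSup b.W) ⟶ _) = glueHom b.W (fun x => 𝟙 _) hid₁ :=
      eq_glueHom _ _ _ _ fun x => restrictHom_id _
    rw [e1, ← e2]
  have hΨΦ : Ψ ≫ Φ = 𝟙 _ := by
    have e1 : Ψ ≫ Φ = glueHom b.W (fun x => 𝟙 _) hid₂ :=
      eq_glueHom _ _ _ _ fun x => by
        rw [restrictHom_comp, restrictHom_glueHom, restrictHom_glueHom,
          localInv_comp_localHom F₁ F₂ h₁ h₂]
    have e2 : (𝟙 _ : E₂.over (iSup b.W) ⟶ _) = glueHom b.W (fun x => 𝟙 _) hid₂ :=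
      eq_glueHom _ _ _ _ fun x => restrictHom_id _
    rw [e1, ← e2]
  exact ⟨isoOfOverCover b.mem ⟨Φ, Ψ, hΦΨ, hΨΦ⟩⟩

end Iso

/-- **Line bundles with the same cocycle class are isomorphic**: if `E₁`, `E₂` carry frame systems
of constant rank `1` whose determinant cocycles have the same class in `Ȟ¹(X, 𝒪_X^×)`, then
`E₁ ≅ E₂` (Hartshorne III Ex. 4.5, injectivity of `Pic X → Ȟ¹(X, 𝒪_X^×)`).
[cite: Hartshorne1977, III Ex. 4.5] -/
theorem nonempty_iso_of_cocycle_equiv (F₁ : FrameSystem E₁) (F₂ : FrameSystem E₂)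
    (h₁ : ∀ x, F₁.rank x = 1) (h₂ : ∀ x, F₂.rank x = 1)
    (h : CechPic.mk F₁.cocycle = CechPic.mk F₂.cocycle) : Nonempty (E₁ ≅ E₂) := by
  obtain ⟨b⟩ := (CechPic.mk_eq_mk_iff _ _).mp h
  exact nonempty_iso_of_coboundary F₁ F₂ h₁ h₂ b

end Literature.AlgebraicGeometry.Modules

end
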